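import Summits.NavierStokesRegularity.FluidComputer.BlockRelPrefire
import Summits.NavierStokesRegularity.FluidComputer.BlockReachVoid
import Mathlib.Analysis.SpecialFunctions.Arsinh

/-!
# THE TWO-MODE BLOCK IS EXHAUSTED AS DESIGNED — FOR EVERY PARAMETER CHOICE

HONEST FRAMING (page 1): this file belongs to a low prior, high value-of-information experiment
on Tao's machine paradigm; it is NOT a claim that NS blows up. Nothing here is a statement about
Navier–Stokes: it is a statement about the lane's own TYPING of the two-mode quadratic block design
(`quadVF k η (a, b) = (−kηab, ka²)`, `BlockQuadGate.lean`) — namely that the pair of premises the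
block CIRCUITS consume (a residue `RelOpenReachBound` / `OpenReachBound` on an open working region
`U`, plus a reach–avoid certificate for the design field on the same `U` from the open input
window) is UNINSTANTIABLE for this design field, whatever the windows `Params`, the region `U`, the
coupling `k > 0`, the design anisotropy `η > 0`, the tolerances and the cycle time `τc > 0`.

WHY (R1-DESIGN §28.2, memo `pub-fluidc-bp3/SWITCH-g39.md` §B; the paper argument of bp3 gen 39,
kernel-checked here). Two landed-ahead lemmas and one closed-form orbit:

* `BlockReachVoid.cert_forall_mem` (ASK 101) — certified curves cannot leave an OPEN working
  region: a reach–avoid certificate on `U` (fields `cert`, `Tube_sub`) keeps every admissible curve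
  from `Ain` — in particular every EXACT orbit of the design field (defect `0 ≤ ε₁`) — inside `U`
  for the whole cycle `[0, τc]` (the first exit time would be certified inside `U`).
* §1 `quadOrbit`, `hasDerivAt_quadOrbit`, `quadOrbit_at` — THE DESIGN'S OWN OUTPUT SWEEP: the
  exact orbit of `quadVF k (s²)` from `(A, 0)` is `(A / cosh θ, (A/s) tanh θ)`, `θ = kAsσ`; the
  orbit through `(a₀ cosh θ, 0)` passes `(a₀, a₀ sinh θ / s)` at time
  `θ/(k a₀ s cosh θ) ≤ 1/(k a₀ s)`.
  Hence (§2 `ray_mem_of_cert`) every certifiable open region containing the orbits from the input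
  ray `{(A, 0) : A ≥ A₀}` contains the whole vertical ray `{a₀} × [0, ∞)`,
  `a₀ = |A₀| + 1/(k √η τc)` (`arsinh` supplies the orbit through any prescribed output level).
* `BlockRelPrefire.not_relOpenReachBound_quad_of_segment` (ASK 115): three collinear clean states
  `(a₀, b)`, `(a₀, b ± r)` in `U` with `4((jrun − jin)/τc + 1) < 4^s r² k η_S` void the residue —
  and on the vertical ray `r` is as large as we please (`r = M/D + 1`).

WHAT IS PROVED (§3, all `[folklore]`):
* `not_relOpenReachBound_quad_of_cert` — for ANY `Params`, any open `U`, any defect level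
  `ε₁ ≥ 0`, any windows `Ain ⊇ {(A,0) : A ≥ A₀}`, `Aout`, any `τc > 0`: a certificate
  `ReachCertificate (quadVF k η) U ε₁ τc Ain Aout` makes `RelOpenReachBound 𝒟 P (quadVF k η) U ε τc`
  EMPTY (`k, η > 0`, `α ≥ 0`, every `ε`).
* `relQuad_exhausted`, `toVarReachCircuit_premises_void` — the lane's shape: the two premises of
  `BlockRelReach.RelOpenReachBound.toVarReachCircuit` (ASK 111: the residue, and a relative
  certificate `RelReachCertificate (quadVF k η) U (relMod ε) τc (AinO P) (AoutO P)`, which is an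
  absolute one by `RelReachCertificate.toReachCertificate`) cannot both be instantiated for the
  quadratic design, for every `Params` (`ε ≥ 0`).
* `not_openReachBound_quad_of_cert`, `toReachCircuit_premises_void` — the same for the absolute
  machine `BlockQuadReach.OpenReachBound.toReachCircuit` (ASK 95), via `OpenReachBound.toRel`.

SO WHAT. Gens 35–38 closed the residue for the lane's `Params.reg` on every region containing the
core window (`BlockReachVoid` … `BlockRelVoid`, `BlockRelPrefire`), leaving RE-TUNING as the one
apparent exit ((T4a′) of R1-DESIGN §27.8); this file removes the parameters: re-tuning
`c0 / δ / s / jrun / aLo`, shrinking or reshaping `U`, tightening the defect level, is not an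
exit, because every region a certificate can live on contains the design's own unbounded output
sweep, on which the erasure budget of the residue is violated. The two-mode block line is
therefore EXHAUSTED AS DESIGNED (ASSEMBLY §2g.9(y), F1); what survives is only the switched
three-mode SPECIFICATION of R1-DESIGN §28.4, untyped.

NOT PROVED / NOT CLAIMED: anything about Navier–Stokes; anything about three-mode or thresholded
designs; emptiness of the residue ALONE (without a certificate) on regions avoiding the sweep
(e.g. bounded input windows: that is `BlockRelPrefire`'s parameter-dependent no-go); the case
`τc = 0`. Deps: `BlockRelPrefire` (115) → `BlockRelVoid` (114) → `BlockRelReach` (111) → …;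
`BlockReachVoid` (101) → `BlockReachProbe` (100) → …; Mathlib `Real.arsinh`.
-/

open Set Filter Topology Metric

namespace Summit.NavierStokesRegularity.FluidComputer

open Literature.Analysis.FluidPDE Literature.Analysis.FluidPDE.Tao2016
open Literature.Analysis.FluidPDE.FluidComputer

namespace BlockDesign

/-! ### §1. The exact orbits of the quadratic design field, in closed form -/

section Orbit

variable {k s A : ℝ}

/-- **The exact design orbit of `quadVF k (s²)` from `(A, 0)`** (`θ = k A s σ`):
`a = A / cosh θ`, `b = (A / s) · sinh θ / cosh θ` (so `a² + s² b² = A²`). [folklore] -/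
noncomputable def quadOrbit (k s A : ℝ) (σ : ℝ) : ℝ × ℝ :=
  (A / Real.cosh (k * A * s * σ),
    A / s * (Real.sinh (k * A * s * σ) / Real.cosh (k * A * s * σ)))

/-- It starts at `(A, 0)`. [folklore] -/
theorem quadOrbit_zero (k s A : ℝ) : quadOrbit k s A 0 = (A, 0) := by
  simp [quadOrbit]

/-- **It solves the design ODE** `x' = quadVF k (s²) x` (`s ≠ 0`). [folklore] -/
theorem hasDerivAt_quadOrbit (hs : s ≠ 0) (σ : ℝ) :
    HasDerivAt (quadOrbit k s A) (quadVF k (s ^ 2) (quadOrbit k s A σ)) σ := by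
  have hθ : HasDerivAt (fun σ : ℝ => k * A * s * σ) (k * A * s) σ := by
    simpa using (hasDerivAt_id σ).const_mul (k * A * s)
  have hC : HasDerivAt (fun σ : ℝ => Real.cosh (k * A * s * σ))
      (Real.sinh (k * A * s * σ) * (k * A * s)) σ := (Real.hasDerivAt_cosh _).comp σ hθ
  have hS : HasDerivAt (fun σ : ℝ => Real.sinh (k * A * s * σ))
      (Real.cosh (k * A * s * σ) * (k * A * s)) σ := (Real.hasDerivAt_sinh _).comp σ hθ
  have hne : Real.cosh (k * A * s * σ) ≠ 0 := (Real.cosh_pos _).ne'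
  have h1 := (hasDerivAt_const σ A).div hC hne
  have h2 := (hS.div hC hne).const_mul (A / s)
  refine (h1.prodMk h2).congr_deriv ?_
  simp only [quadVF, quadOrbit, Prod.mk.injEq]
  set θ : ℝ := k * A * s * σ with hθdef
  have hcs := Real.cosh_sq_sub_sinh_sq θ
  constructor
  · field_simp
    ring
  · field_simp
    linear_combination (k * A ^ 2) * hcs

/-- Continuity of the orbit. [folklore] -/
theorem continuous_quadOrbit (hs : s ≠ 0) : Continuous (quadOrbit k s A) :=
  continuous_iff_continuousAt.2 fun σ => (hasDerivAt_quadOrbit hs σ).continuousAt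

/-- **The output sweep**: the orbit through `(a₀ cosh θ, 0)` passes `(a₀, a₀ sinh θ / s)` at time
`θ / (k a₀ cosh θ s)`. [folklore] -/
theorem quadOrbit_at (hk : k ≠ 0) (hs : s ≠ 0) {a₀ : ℝ} (ha : a₀ ≠ 0) (θ : ℝ) :
    quadOrbit k s (a₀ * Real.cosh θ) (θ / (k * (a₀ * Real.cosh θ) * s)) =
      (a₀, a₀ * Real.sinh θ / s) := by
  have hch : Real.cosh θ ≠ 0 := (Real.cosh_pos θ).ne'
  have hθ : k * (a₀ * Real.cosh θ) * s * (θ / (k * (a₀ * Real.cosh θ) * s)) = θ := by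
    field_simp
  simp only [quadOrbit, hθ, Prod.mk.injEq]
  constructor
  · field_simp
  · field_simp

/-- `θ ≤ cosh θ` for `θ ≥ 0`. [folklore] -/
theorem self_le_cosh {θ : ℝ} (hθ : 0 ≤ θ) : θ ≤ Real.cosh θ :=
  ((Real.self_le_sinh_iff).2 hθ).trans (Real.sinh_lt_cosh θ).le

end Orbit

/-! ### §2. Certified regions contain the input ray and a whole vertical ray -/

section Sweep

variable {𝒟 : CascadeWaveletData 1 1} {S : CascadeSpecs} {P : Params S} {k η ε τc : ℝ}
variable {U Ain Aout : Set (ℝ × ℝ)} {ε₁ A₀ : ℝ}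

/-- **Step 1**: every exact design orbit from the input ray `{(A, 0) : A ≥ A₀} ⊆ Ain` stays in
the certified open region `U` during the whole cycle (`η > 0`, defect level `ε₁ ≥ 0`) — by
`BlockReachVoid.cert_forall_mem` (certified curves cannot leave an open working region) applied to
the exact orbit, whose defect is `0 ≤ ε₁`. [folklore] -/
theorem quadOrbit_mem_of_cert (hη : 0 < η) (hU : IsOpen U) (hε₁ : 0 ≤ ε₁)
    (hray : ∀ A : ℝ, A₀ ≤ A → ((A, 0) : ℝ × ℝ) ∈ Ain)
    (c : ReachCertificate (quadVF k η) U ε₁ τc Ain Aout) {A : ℝ} (hA : A₀ ≤ A) :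
    ∀ σ ∈ Icc 0 τc, quadOrbit k (Real.sqrt η) A σ ∈ U := by
  have hs : Real.sqrt η ≠ 0 := (Real.sqrt_pos.2 hη).ne'
  have hs2 : Real.sqrt η ^ 2 = η := Real.sq_sqrt hη.le
  refine cert_forall_mem c hU (hray A hA) (quadOrbit_zero _ _ _) (continuous_quadOrbit hs)
    fun σ _ _ => ⟨_, (hasDerivAt_quadOrbit hs σ).hasDerivWithinAt, ?_⟩
  rw [hs2, sub_self, norm_zero]
  exact hε₁

/-- **Step 1′**: in particular the input ray itself lies in `U`. [folklore] -/
theorem inputRay_mem_of_cert (hη : 0 < η) (hτ : 0 ≤ τc) (hU : IsOpen U) (hε₁ : 0 ≤ ε₁)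
    (hray : ∀ A : ℝ, A₀ ≤ A → ((A, 0) : ℝ × ℝ) ∈ Ain)
    (c : ReachCertificate (quadVF k η) U ε₁ τc Ain Aout) :
    ∀ A : ℝ, A₀ ≤ A → ((A, 0) : ℝ × ℝ) ∈ U := fun A hA => by
  simpa [quadOrbit_zero] using quadOrbit_mem_of_cert hη hU hε₁ hray c hA 0 ⟨le_rfl, hτ⟩

/-- **Step 2 (THE OUTPUT SWEEP IS CERTIFIED)**: the whole vertical ray `{a₀} × [0, ∞)`,
`a₀ = |A₀| + 1/(k √η τc)`, lies in `U` (`k, η, τc > 0`, `ε₁ ≥ 0`). [folklore] -/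
theorem ray_mem_of_cert (hk : 0 < k) (hη : 0 < η) (hτ : 0 < τc) (hU : IsOpen U)
    (hε₁ : 0 ≤ ε₁) (hray : ∀ A : ℝ, A₀ ≤ A → ((A, 0) : ℝ × ℝ) ∈ Ain)
    (c : ReachCertificate (quadVF k η) U ε₁ τc Ain Aout) {v : ℝ} (hv : 0 ≤ v) :
    ((|A₀| + 1 / (k * Real.sqrt η * τc), v) : ℝ × ℝ) ∈ U := by
  have hs : 0 < Real.sqrt η := Real.sqrt_pos.2 hη
  set a₀ : ℝ := |A₀| + 1 / (k * Real.sqrt η * τc) with ha₀def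
  have hkst : 0 < k * Real.sqrt η * τc := by positivity
  have ha₀ : 0 < a₀ := by
    have := abs_nonneg A₀
    have := one_div_pos.2 hkst
    rw [ha₀def]; linarith
  have hA₀a : A₀ ≤ a₀ := (le_abs_self A₀).trans (by rw [ha₀def]; linarith [one_div_pos.2 hkst])
  have hka : 1 ≤ k * a₀ * Real.sqrt η * τc := by
    have h1 : k * a₀ * Real.sqrt η * τc = (k * Real.sqrt η * τc) * |A₀| + 1 := by
      rw [ha₀def]; field_simp
    rw [h1]; nlinarith [abs_nonneg A₀, hkst]
  obtain ⟨θ, hθ0, hsinh⟩ : ∃ θ : ℝ, 0 ≤ θ ∧ a₀ * Real.sinh θ / Real.sqrt η = v :=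
    ⟨Real.arsinh (v * Real.sqrt η / a₀), Real.arsinh_nonneg_iff.2 (by positivity),
      by rw [Real.sinh_arsinh]; field_simp⟩
  have hch : 0 < Real.cosh θ := Real.cosh_pos θ
  have hA : A₀ ≤ a₀ * Real.cosh θ :=
    hA₀a.trans (le_mul_of_one_le_right ha₀.le (Real.one_le_cosh θ))
  have hpos : 0 < k * (a₀ * Real.cosh θ) * Real.sqrt η := by positivity
  have hσ0 : 0 ≤ θ / (k * (a₀ * Real.cosh θ) * Real.sqrt η) := div_nonneg hθ0 hpos.le
  have hστ : θ / (k * (a₀ * Real.cosh θ) * Real.sqrt η) ≤ τc := by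
    rw [div_le_iff₀ hpos]
    have h1 : θ ≤ Real.cosh θ := self_le_cosh hθ0
    have h2 : Real.cosh θ ≤ Real.cosh θ * (k * a₀ * Real.sqrt η * τc) :=
      le_mul_of_one_le_right hch.le hka
    calc θ ≤ Real.cosh θ * (k * a₀ * Real.sqrt η * τc) := h1.trans h2
      _ = τc * (k * (a₀ * Real.cosh θ) * Real.sqrt η) := by ring
  have hmem := quadOrbit_mem_of_cert hη hU hε₁ hray c hA _ ⟨hσ0, hστ⟩
  rwa [quadOrbit_at hk.ne' hs.ne' ha₀.ne', hsinh] at hmem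

/-! ### §3. The no-go for every parameter choice -/

/-- **THE TWO-MODE BLOCK IS EXHAUSTED AS DESIGNED (general form).** For ANY windows `Params`,
any open working region `U`, any defect level `ε₁ ≥ 0`, any `Ain ⊇ {(A, 0) : A ≥ A₀}`, any `Aout`
and any cycle time `τc > 0`: a reach–avoid certificate `ReachCertificate (quadVF k η) U ε₁ τc Ain
Aout` makes the residue `RelOpenReachBound 𝒟 P (quadVF k η) U ε τc` EMPTY (`k, η > 0`, `α ≥ 0`,
every `ε`). Proof: the certified region contains the input ray and the vertical ray
`{a₀} × [0, ∞)` (§2), on which `not_relOpenReachBound_quad_of_segment` (ASK 115) applies with `r`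
as large as the budget `4((jrun − jin)/τc + 1) < 4^s r² k η_S` asks. [folklore] -/
theorem not_relOpenReachBound_quad_of_cert (hα : 0 ≤ S.alpha) (hk : 0 < k) (hη : 0 < η)
    (hτ : 0 < τc) (hU : IsOpen U) (hε₁ : 0 ≤ ε₁)
    (hray : ∀ A : ℝ, A₀ ≤ A → ((A, 0) : ℝ × ℝ) ∈ Ain)
    (c : ReachCertificate (quadVF k η) U ε₁ τc Ain Aout) :
    IsEmpty (RelOpenReachBound 𝒟 P (quadVF k η) U ε τc) := by
  have hU0 := inputRay_mem_of_cert hη hτ.le hU hε₁ hray c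
  set D : ℝ := (4 : ℝ) ^ P.s * k * S.eta with hDdef
  set M : ℝ := 4 * ((P.jrun - P.jin) / τc + 1) with hMdef
  have hD : 0 < D := by
    have h4 := Real.rpow_pos_of_pos (by norm_num : (0 : ℝ) < 4) P.s
    have hη' := S.eta_pos
    rw [hDdef]; positivity
  have hD0 : D ≠ 0 := hD.ne'
  have hM : 0 ≤ M := by
    have h := div_nonneg (sub_nonneg.2 P.jin_le_jrun) hτ.le
    rw [hMdef]; linarith
  set r : ℝ := M / D + 1 with hrdef
  have hr1 : 1 ≤ r := le_add_of_nonneg_left (div_nonneg hM hD.le)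
  have hr0 : 0 ≤ r := zero_le_one.trans hr1
  have hbig : M < (4 : ℝ) ^ P.s * r ^ 2 * k * S.eta := by
    have h1 : (4 : ℝ) ^ P.s * r ^ 2 * k * S.eta = D * r ^ 2 := by rw [hDdef]; ring
    have h2 : D * r = M + D := by rw [hrdef]; field_simp
    have h3 : D * r ≤ D * r ^ 2 := by
      nlinarith [mul_nonneg (mul_nonneg hD.le hr0) (sub_nonneg.2 hr1)]
    rw [h1]; linarith
  have hv := fun (v : ℝ) (hv : 0 ≤ v) => ray_mem_of_cert hk hη hτ hU hε₁ hray c hv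
  exact not_relOpenReachBound_quad_of_segment hα hk hτ hU0 (hv r hr0)
    (hv (r + r) (add_nonneg hr0 hr0)) (hv (r - r) (sub_self r).ge) hbig

/-- `(A, 0) ∈ AinO P` for `A ≥ aLo`: the open input window contains the input ray. [folklore] -/
theorem inputRay_subset_AinO : ∀ A : ℝ, P.aLo ≤ A → ((A, 0) : ℝ × ℝ) ∈ AinO P :=
  fun _ hA => mem_AinO_base (by linarith [P.δ_pos])

/-- **THE TWO-MODE BLOCK IS EXHAUSTED AS DESIGNED (the lane's relative machine, every `Params`).**
A relative certificate `RelReachCertificate (quadVF k η) U (relMod ε') τc (AinO P) (AoutO P)` on an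
open `U` (`ε' ≥ 0`; it is in particular an absolute one at level `ε'`,
`RelReachCertificate.toReachCertificate`) makes `RelOpenReachBound 𝒟 P (quadVF k η) U ε τc`
EMPTY — for every `Params S`, `k, η, τc > 0`, `α ≥ 0`, every `ε`. [folklore] -/
theorem relQuad_exhausted (hα : 0 ≤ S.alpha) (hk : 0 < k) (hη : 0 < η) (hτ : 0 < τc)
    {ε' : ℝ} (hε' : 0 ≤ ε') (hU : IsOpen U)
    (c : RelReachCertificate (quadVF k η) U (relMod ε') τc (AinO P) (AoutO P)) :
    IsEmpty (RelOpenReachBound 𝒟 P (quadVF k η) U ε τc) :=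
  not_relOpenReachBound_quad_of_cert hα hk hη hτ hU hε' inputRay_subset_AinO
    (c.toReachCertificate hε')

/-- **The premises of `RelOpenReachBound.toVarReachCircuit` (ASK 111) are jointly uninstantiable
for the quadratic design**: given the residue, NO relative certificate from `AinO P` exists on `U` —
for every `Params` (`ε ≥ 0`, `τc > 0`, `k, η > 0`, `α ≥ 0`). [folklore] -/
theorem toVarReachCircuit_premises_void (hα : 0 ≤ S.alpha) (hk : 0 < k) (hη : 0 < η)
    (hτ : 0 < τc) (hε : 0 ≤ ε) (hU : IsOpen U) (H : RelOpenReachBound 𝒟 P (quadVF k η) U ε τc) :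
    ¬ Nonempty (RelReachCertificate (quadVF k η) U (relMod ε) τc (AinO P) (AoutO P)) :=
  fun ⟨c⟩ => (relQuad_exhausted hα hk hη hτ hε hU c).false H

/-- **The absolute machine too**: an absolute certificate `ReachCertificate (quadVF k η) U ε₁ 1 Ain
Aout` (`ε₁ ≥ 0`, `Ain ⊇` input ray) on an open `U` makes `OpenReachBound 𝒟 P (quadVF k η) U ε`
(ASK 95) EMPTY for every `ε ≥ 0` (via `OpenReachBound.toRel`, ASK 111). [folklore] -/
theorem not_openReachBound_quad_of_cert (hα : 0 ≤ S.alpha) (hk : 0 < k) (hη : 0 < η)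
    (hε : 0 ≤ ε) (hU : IsOpen U) (hε₁ : 0 ≤ ε₁)
    (hray : ∀ A : ℝ, A₀ ≤ A → ((A, 0) : ℝ × ℝ) ∈ Ain)
    (c : ReachCertificate (quadVF k η) U ε₁ 1 Ain Aout) :
    IsEmpty (OpenReachBound 𝒟 P (quadVF k η) U ε) :=
  ⟨fun H => (not_relOpenReachBound_quad_of_cert hα hk hη one_pos hU hε₁ hray c).false (H.toRel hε)⟩

/-- **The premises of `OpenReachBound.toReachCircuit` (ASK 95) are jointly uninstantiable for the
quadratic design**: given the absolute residue, NO certificate from `AinO P` exists on `U` — for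
every `Params` (`ε ≥ 0`, `k, η > 0`, `α ≥ 0`). [folklore] -/
theorem toReachCircuit_premises_void (hα : 0 ≤ S.alpha) (hk : 0 < k) (hη : 0 < η) (hε : 0 ≤ ε)
    (hU : IsOpen U) (H : OpenReachBound 𝒟 P (quadVF k η) U ε) :
    ¬ Nonempty (ReachCertificate (quadVF k η) U ε 1 (AinO P) (AoutO P)) :=
  fun ⟨c⟩ => (not_openReachBound_quad_of_cert hα hk hη hε hU hε inputRay_subset_AinO c).false H

end Sweep

end BlockDesign

end Summit.NavierStokesRegularity.FluidComputer
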